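import Literature.NumberTheory.LFunctions.SelbergClass
import HarnessLib

/-!
# Strong multiplicity one for the Selberg class off a thin set of primes (Soundararajan)

Topic `NumberTheory/LFunctions`.  K. Soundararajan, *Strong multiplicity one for the Selberg
class*, Canad. Math. Bull. 47 (2004) 468–474 = arXiv:math/0210299 [Soundararajan2002], the
Theorem on p. 1 of the arXiv version, vendored AS PRINTED as a named fact over the tree's
`SelbergDatum` (`SelbergClass.lean`; coefficients `coeff`, degree `degree = 2 ∑ λⱼ`):

  "Theorem. Suppose `F` and `G` are elements of the Selberg class with `a_F(p) = a_G(p)`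
  (equivalently, `b_F(p) = b_G(p)`) for all `p ∉ 𝓔` where `𝓔` is a thin set of primes satisfying
  `#{p ∈ 𝓔, p ≤ x} ≪ x^{1/2 − δ}` (2) for some fixed `δ > 0`.  Then `F` and `G` have the same
  degree: `d_F = d_G`.  If in addition we have
  `∑_{p ≤ e^x} |a_F(p²) − a_G(p²)|² (log p)/p ≪ exp(x / (log x (log₂ x)⁵))` (3), then `F = G`."

(`log₂ = log log`.)  Context printed ibid.: the strong multiplicity one PRINCIPLE for `𝒮`
(finitely many exceptional primes ⇒ `F = G`) is open in general; Murty–Murty [MurtyMurty1994]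
prove it under `a_F(p²) = a_G(p²)` for all but finitely many `p`, Kaczorowski–Perelli
[KaczorowskiPerelli2001] under `lim_{σ→1⁺} (σ−1) ∑_p |a_F(p²) − a_G(p²)| p^{−σ} log p < ∞`;
hypothesis (3) is weaker than both, and (2) allows an infinite (thin) exceptional set.

"`F = G`" is rendered as equality of the Dirichlet coefficients at every `n ≥ 1` together with
equality of the functions off the possible pole `s = 1` (the value of `SelbergDatum.toFun` at
`s = 1` is unconstrained by the structure); both are what the printed identity of the two elements
of `𝒮` means.

Why here (grounding, route Langlands/`DisagreementBeurling`): the support item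
`Summit.Langlands.Langlands.Theses.DisagreementBeurling.SparseMultiplicityOne` (stmt-Langlands-13719,
"sparse mixed multiplicity one, credited to Murty–Murty / Kaczorowski–Perelli / Soundararajan")
asks: a cuspidal `P` on `GL_n(𝔸_F)` of Artin infinity type and an `n`-dimensional Artin `ρ` that
are Frobenius–Satake compatible outside `S ∪ T`, `S` finite and `T` of exponent of convergence
`< 1/2` (`∑_{v∈T} q_v^{−σ} < ∞` for some `σ < 1/2` — over `ℚ` exactly a set of primes with (2)),
are compatible on `T` as well.  This fact is the nearest PRINTED theorem (same thin-set threshold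
`1/2`, same overlap-of-half-planes mechanism); it does NOT imply the item: there the second
`L`-function is an Artin `L`-function (membership in `𝒮` = Artin's holomorphy conjecture), the
base field is arbitrary and the conclusion is place-by-place compatibility.

## References

* K. Soundararajan, *Strong multiplicity one for the Selberg class*, Canad. Math. Bull. 47 (2004)
  468–474; arXiv:math/0210299, Theorem (p. 1). [Soundararajan2002]
* M. R. Murty, V. K. Murty, *Strong multiplicity one for Selberg's class*, C. R. Acad. Sci. Paris
  319 (1994) 315–320. [MurtyMurty1994]
* J. Kaczorowski, A. Perelli, *Strong multiplicity one for the Selberg class*, C. R. Acad. Sci.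
  Paris 332 (2001) 963–968. [KaczorowskiPerelli2001]
-/

noncomputable section

open Finset Real

namespace Literature.NumberTheory.LFunctions

/-- **Soundararajan, strong multiplicity one for the Selberg class off a thin set** (Canad. Math.
Bull. 47 (2004), Theorem; arXiv:math/0210299 p. 1), as printed: let `F, G ∈ 𝒮` (two
`SelbergDatum`s) and let `𝓔` be a set of primes with `#{p ∈ 𝓔 : p ≤ x} ≤ C x^{1/2−δ}` for some
fixed `δ > 0` (all `x ≥ 2`), such that `a_F(p) = a_G(p)` for every prime `p ∉ 𝓔`.  Then
(i) `d_F = d_G`; and (ii) if moreover, for all large `x`,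
`∑_{p ≤ e^x} |a_F(p²) − a_G(p²)|² (log p)/p ≤ C' exp(x/(log x · (log log x)⁵))`, then `F = G`
(same Dirichlet coefficients at every `n ≥ 1`, and the same function off `s = 1`).  Named fact, not
proved here.  Nearest print to (NOT a proof of)
`Summit.Langlands.Langlands.Theses.DisagreementBeurling.SparseMultiplicityOne` (mixed
automorphic/Artin, number fields, places).
[cite: Soundararajan2002, Theorem] -/
def Soundararajan2004_strongMultiplicityOne_thinSet : Prop :=
  ∀ (D₁ D₂ : SelbergDatum) (𝓔 : Set ℕ) (δ C : ℝ), 0 < δ →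
    (∀ x : ℝ, 2 ≤ x →
      (Set.ncard {p : ℕ | p ∈ 𝓔 ∧ p.Prime ∧ (p : ℝ) ≤ x} : ℝ) ≤ C * x ^ (1 / 2 - δ)) →
    (∀ p : ℕ, p.Prime → p ∉ 𝓔 → D₁.coeff p = D₂.coeff p) →
    D₁.degree = D₂.degree ∧
    ((∃ C' x₀ : ℝ, ∀ x : ℝ, x₀ ≤ x →
        ∑ p ∈ (Finset.Iic ⌊Real.exp x⌋₊).filter Nat.Prime,
            ‖D₁.coeff (p ^ 2) - D₂.coeff (p ^ 2)‖ ^ 2 / (p : ℝ) * Real.log p ≤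
          C' * Real.exp (x / (Real.log x * Real.log (Real.log x) ^ 5))) →
      (∀ n : ℕ, 1 ≤ n → D₁.coeff n = D₂.coeff n) ∧
        ∀ s : ℂ, s ≠ 1 → D₁.toFun s = D₂.toFun s)

end Literature.NumberTheory.LFunctions

end
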